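import Literature.NumberTheory.Automorphic.WeightFormsHom
import HarnessLib

/-!
# Weight forms from an equivariant family of scalar forms (the `K`-type of a lift)

Topic `NumberTheory/Automorphic`; namespace `Literature.NumberTheory.Automorphic.WeightForms`
(continues `WeightForms`, `WeightFormsHom`). Purely algebraic; generic over a group `G ⊇ Γ`,
`κ : Kc →* G`, a weight `τ : Representation R Kc W` and a commutative ring `R`.

## What this file provides

The standard passage from SCALAR automorphic forms produced by an equivariant machine to a
VECTOR-VALUED form of weight `τ`.  The machine is a linear map `Θ : E →ₗ[R] (G → R)` on a
`Kc`-module `(E, σ)` of "test vectors" (for a theta lift: `E` = a finite-dimensional `K_∞`-stable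
space of archimedean Schwartz functions, `σ = ω_∞|_{K_∞}` on it, `Θ φ_∞ = (g ↦ θ(φ_∞ ⊗ φ_f, χ′)(g))`)
whose values are left `Γ`-invariant and which is EQUIVARIANT for right translation,
`Θ (σ k e) (g) = Θ e (g κ(k))` (for theta lifts this is the kernel law `θ_Φ(g k) = θ_{ω(k)Φ}(g)`,
the tree's `Weil1964.thetaLiftFun_mul_right` shape).  Given a `Kc`-map `ι : W^∨ → E` from the
contragredient of the target weight (an embedding of the `K`-type `τ^∨` into the test vectors):

* `ofFamily Θ hΓ hK ι hι : homForms Γ κ τ` — the equivariant homomorphism `ℓ ↦ Θ (ι ℓ)`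
  (`Hom_{Kc}(τ^∨, Fun(Γ \ G))` side), `ofFamily_apply`;
* `formOfFamily … : weightForms Γ κ τ` — for a reflexive weight module, the `τ`-VALUED form
  `f` with `ℓ (f g) = Θ (ι ℓ) g` (`apply_formOfFamily`), via Frobenius reciprocity `homEquiv`
  (`WeightFormsHom`);
* NON-VANISHING TRANSFER: `ofFamily_eq_zero_iff`, `formOfFamily_eq_zero_iff`
  (`f = 0 ↔ ∀ ℓ g, Θ (ι ℓ) g = 0`), and the form used downstream
  **`formOfFamily_ne_zero_of_apply_ne_zero`**: if `ι` is onto (the test space IS the `K`-type) and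
  ONE scalar value `Θ e g₀ ≠ 0`, then the weight-`τ` form is nonzero; `formOfFamily_ne_zero_iff_of_surjective`.
* Functoriality in the machine: `ofFamily_add/smul` (linearity in `Θ`), and `ofFamily_comp`
  (shrinking the test space along a `Kc`-map).

This is exactly the representation-theoretic step "a nonzero lift `θ(φ, χ′)` with `φ_∞` inside a
`K_∞`-type `τ^∨` gives a nonzero automorphic form of weight `τ`" used when theta lifts are read as
vector-valued forms / differential forms on locally symmetric spaces (Borel–Wallach VII §2–3 set-up:
`(C^∞(Γ\G) ⊗ W)^K = Hom_K(W^∨, C^∞(Γ\G))`; for Picard modular surfaces `τ = 𝔭₊^∨`, `dim W = 2`, so the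
one-dimensional "eigenvector" version does not suffice).  Everything is proved; tags are provenance.
Deliberately NOT here: any topology, the theta machine itself (`Weil1964/*`), injectivity into
cohomology (Matsushima), complete reducibility of `E`.
-/

open Function Module

namespace Literature.NumberTheory.Automorphic

namespace WeightForms

variable {G : Type*} [Group G] {Kc : Type*} [Group Kc]
variable {R : Type*} [CommRing R]
variable {W : Type*} [AddCommGroup W] [Module R W]
variable {E : Type*} [AddCommGroup E] [Module R E]
variable {Γ : Subgroup G} {κ : Kc →* G} {τ : Representation R Kc W} {σ : Representation R Kc E}

section Hom

/-- **The equivariant homomorphism of an equivariant family.**  For a linear "lift"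
`Θ : E → Fun(G, R)` with left `Γ`-invariant values (`hΓ`) which intertwines `σ` with right
translation through `κ` (`hK : Θ (σ k e) = ρ(k) (Θ e)`, i.e. `Θ (σ k e) g = Θ e (g κ k)`), and a
`Kc`-map `ι : W^∨ → E` from the contragredient of `τ` (`hι : ι (τ^∨ k ℓ) = σ k (ι ℓ)`), the composite
`ℓ ↦ Θ (ι ℓ)` lies in `homForms Γ κ τ = Hom_{Kc}(τ^∨, Fun(Γ \ G))`. [folklore] -/
def ofFamily (Θ : E →ₗ[R] (G → R)) (hΓ : ∀ e, Θ e ∈ leftInvariantFun R R Γ)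
    (hK : ∀ (k : Kc) (e : E), Θ (σ k e) = rightRep R κ R k (Θ e))
    (ι : Dual R W →ₗ[R] E) (hι : ∀ (k : Kc) (ℓ : Dual R W), ι (τ.dual k ℓ) = σ k (ι ℓ)) :
    homForms Γ κ τ :=
  ⟨Θ ∘ₗ ι, ⟨fun k ℓ ↦ by rw [LinearMap.comp_apply, LinearMap.comp_apply, hι, hK], fun ℓ ↦ hΓ (ι ℓ)⟩⟩

variable {Θ : E →ₗ[R] (G → R)} {hΓ : ∀ e, Θ e ∈ leftInvariantFun R R Γ}
  {hK : ∀ (k : Kc) (e : E), Θ (σ k e) = rightRep R κ R k (Θ e)}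
  {ι : Dual R W →ₗ[R] E} {hι : ∀ (k : Kc) (ℓ : Dual R W), ι (τ.dual k ℓ) = σ k (ι ℓ)}

/-- Underlying linear map of `ofFamily`: `Θ ∘ ι`. [folklore] -/
@[simp] theorem coe_ofFamily :
    ((ofFamily Θ hΓ hK ι hι : homForms Γ κ τ) : Dual R W →ₗ[R] (G → R)) = Θ ∘ₗ ι := rfl

/-- `ofFamily Θ … ι ℓ g = Θ (ι ℓ) g`. [folklore] -/
@[simp] theorem ofFamily_apply (ℓ : Dual R W) (g : G) :
    ((ofFamily Θ hΓ hK ι hι : homForms Γ κ τ) : Dual R W →ₗ[R] (G → R)) ℓ g = Θ (ι ℓ) g := rfl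

/-- `ofFamily … = 0 ↔` every scalar form `Θ (ι ℓ)` vanishes identically. [folklore] -/
theorem ofFamily_eq_zero_iff :
    (ofFamily Θ hΓ hK ι hι : homForms Γ κ τ) = 0 ↔ ∀ (ℓ : Dual R W) (g : G), Θ (ι ℓ) g = 0 := by
  rw [← Submodule.coe_eq_zero, coe_ofFamily]
  constructor
  · intro h ℓ g
    have := LinearMap.congr_fun h ℓ
    rw [LinearMap.comp_apply, LinearMap.zero_apply] at this
    rw [this, Pi.zero_apply]
  · intro h
    ext ℓ g
    rw [LinearMap.comp_apply, LinearMap.zero_apply, Pi.zero_apply, h]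

/-- NON-VANISHING, homomorphism side: one nonzero scalar value `Θ (ι ℓ) g ≠ 0` makes the equivariant
homomorphism nonzero. [folklore] -/
theorem ofFamily_ne_zero_of_apply_ne_zero {ℓ : Dual R W} {g : G} (h : Θ (ι ℓ) g ≠ 0) :
    (ofFamily Θ hΓ hK ι hι : homForms Γ κ τ) ≠ 0 := fun h0 ↦
  h ((ofFamily_eq_zero_iff.mp h0) ℓ g)

/-- If `ι : W^∨ → E` is onto (the test space is the `K`-type `τ^∨` itself, or a quotient of it) then
`ofFamily … = 0 ↔ Θ` kills every test vector. [folklore] -/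
theorem ofFamily_eq_zero_iff_of_surjective (hsurj : Surjective ι) :
    (ofFamily Θ hΓ hK ι hι : homForms Γ κ τ) = 0 ↔ ∀ (e : E) (g : G), Θ e g = 0 := by
  rw [ofFamily_eq_zero_iff]
  constructor
  · intro h e g
    obtain ⟨ℓ, rfl⟩ := hsurj e
    exact h ℓ g
  · intro h ℓ g
    exact h (ι ℓ) g

/-- Linearity of `ofFamily` in the machine `Θ`: sum. [folklore] -/
theorem ofFamily_add {Θ' : E →ₗ[R] (G → R)} {hΓ' : ∀ e, Θ' e ∈ leftInvariantFun R R Γ}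
    {hK' : ∀ (k : Kc) (e : E), Θ' (σ k e) = rightRep R κ R k (Θ' e)}
    (hΓ'' : ∀ e, (Θ + Θ') e ∈ leftInvariantFun R R Γ)
    (hK'' : ∀ (k : Kc) (e : E), (Θ + Θ') (σ k e) = rightRep R κ R k ((Θ + Θ') e)) :
    (ofFamily (Θ + Θ') hΓ'' hK'' ι hι : homForms Γ κ τ) =
      ofFamily Θ hΓ hK ι hι + ofFamily Θ' hΓ' hK' ι hι := by
  apply Subtype.ext
  simp [LinearMap.add_comp]

/-- Linearity of `ofFamily` in the machine `Θ`: scalar multiple. [folklore] -/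
theorem ofFamily_smul (c : R) (hΓc : ∀ e, (c • Θ) e ∈ leftInvariantFun R R Γ)
    (hKc : ∀ (k : Kc) (e : E), (c • Θ) (σ k e) = rightRep R κ R k ((c • Θ) e)) :
    (ofFamily (c • Θ) hΓc hKc ι hι : homForms Γ κ τ) = c • ofFamily Θ hΓ hK ι hι := by
  apply Subtype.ext
  simp [LinearMap.smul_comp]

/-- Shrinking the test space: for a linear `j : E' → E`, the family `Θ ∘ j` on `E'` with
`ι' : W^∨ → E'` gives the same homomorphism as `Θ` with `ι = j ∘ ι'` (whatever equivariance
witnesses are supplied on the two sides; for a `Kc`-map `j` they exist by `comp_equivariant`).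
[folklore] -/
theorem ofFamily_comp {E' : Type*} [AddCommGroup E'] [Module R E'] {σ' : Representation R Kc E'}
    (j : E' →ₗ[R] E) (ι' : Dual R W →ₗ[R] E') (hι' : ∀ (k : Kc) (ℓ : Dual R W), ι' (τ.dual k ℓ) = σ' k (ι' ℓ))
    (hΓj : ∀ e', (Θ ∘ₗ j) e' ∈ leftInvariantFun R R Γ)
    (hKj : ∀ (k : Kc) (e' : E'), (Θ ∘ₗ j) (σ' k e') = rightRep R κ R k ((Θ ∘ₗ j) e'))
    (hιj : ∀ (k : Kc) (ℓ : Dual R W), (j ∘ₗ ι') (τ.dual k ℓ) = σ k ((j ∘ₗ ι') ℓ)) :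
    (ofFamily (Θ ∘ₗ j) hΓj hKj ι' hι' : homForms Γ κ τ) = ofFamily Θ hΓ hK (j ∘ₗ ι') hιj := by
  apply Subtype.ext
  rfl

/-- The hypotheses of `ofFamily_comp` hold automatically (packaged): composite families are
equivariant. [folklore] -/
theorem comp_equivariant {E' : Type*} [AddCommGroup E'] [Module R E'] {σ' : Representation R Kc E'}
    (j : E' →ₗ[R] E) (hj : ∀ (k : Kc) (e' : E'), j (σ' k e') = σ k (j e'))
    (hK₀ : ∀ (k : Kc) (e : E), Θ (σ k e) = rightRep R κ R k (Θ e)) (k : Kc) (e' : E') :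
    (Θ ∘ₗ j) (σ' k e') = rightRep R κ R k ((Θ ∘ₗ j) e') := by
  rw [LinearMap.comp_apply, LinearMap.comp_apply, hj, hK₀]

end Hom

section Form

variable [IsReflexive R W]
variable (Θ : E →ₗ[R] (G → R)) (hΓ : ∀ e, Θ e ∈ leftInvariantFun R R Γ)
  (hK : ∀ (k : Kc) (e : E), Θ (σ k e) = rightRep R κ R k (Θ e))
  (ι : Dual R W →ₗ[R] E) (hι : ∀ (k : Kc) (ℓ : Dual R W), ι (τ.dual k ℓ) = σ k (ι ℓ))

/-- **The weight-`τ` form of an equivariant family** (reflexive weight module, e.g. `W`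
finite-dimensional over a field): the `W`-valued function `f` on `G` with `ℓ (f g) = Θ (ι ℓ) g` for all
`ℓ ∈ W^∨` — left `Γ`-invariant and `f (g κ k) = τ(k)⁻¹ f(g)`.  Obtained from `ofFamily` by Frobenius
reciprocity `homEquiv : weightForms ≃ homForms` (`WeightFormsHom`). [folklore] -/
noncomputable def formOfFamily : weightForms Γ κ τ :=
  (homEquiv Γ κ τ).symm (ofFamily Θ hΓ hK ι hι)

/-- `homEquiv (formOfFamily …) = ofFamily …`. [folklore] -/
@[simp] theorem homEquiv_formOfFamily :
    homEquiv Γ κ τ (formOfFamily Θ hΓ hK ι hι) = ofFamily Θ hΓ hK ι hι :=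
  LinearEquiv.apply_symm_apply _ _

/-- Defining property: `ℓ (f g) = Θ (ι ℓ) g`. [folklore] -/
@[simp] theorem apply_formOfFamily (g : G) (ℓ : Dual R W) :
    ℓ ((formOfFamily Θ hΓ hK ι hι : G → W) g) = Θ (ι ℓ) g := by
  rw [formOfFamily, homEquiv_symm_apply, apply_ofHom_apply, ofFamily_apply]

/-- The weight form is left `Γ`-invariant and right `τ⁻¹`-equivariant (restated from membership, for
convenience downstream). [folklore] -/
theorem formOfFamily_mem : ((formOfFamily Θ hΓ hK ι hι : weightForms Γ κ τ) : G → W) ∈ weightForms Γ κ τ :=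
  (formOfFamily Θ hΓ hK ι hι).2

/-- `formOfFamily … = 0 ↔` every scalar form `Θ (ι ℓ)` vanishes identically. [folklore] -/
theorem formOfFamily_eq_zero_iff :
    formOfFamily Θ hΓ hK ι hι = (0 : weightForms Γ κ τ) ↔ ∀ (ℓ : Dual R W) (g : G), Θ (ι ℓ) g = 0 := by
  rw [formOfFamily, LinearEquiv.map_eq_zero_iff, ofFamily_eq_zero_iff]

/-- **Non-vanishing transfer**: one nonzero scalar value `Θ (ι ℓ) g ≠ 0` gives a NONZERO form of
weight `τ`. [folklore] -/
theorem formOfFamily_ne_zero_of_apply_ne_zero' {ℓ : Dual R W} {g : G} (h : Θ (ι ℓ) g ≠ 0) :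
    formOfFamily Θ hΓ hK ι hι ≠ (0 : weightForms Γ κ τ) := fun h0 ↦
  h ((formOfFamily_eq_zero_iff Θ hΓ hK ι hι).mp h0 ℓ g)

/-- With `ι` onto (the test space is the `K`-type): `formOfFamily … = 0 ↔ Θ e = 0` for every test
vector `e`. [folklore] -/
theorem formOfFamily_eq_zero_iff_of_surjective (hsurj : Surjective ι) :
    formOfFamily Θ hΓ hK ι hι = (0 : weightForms Γ κ τ) ↔ ∀ (e : E) (g : G), Θ e g = 0 := by
  rw [formOfFamily, LinearEquiv.map_eq_zero_iff, ofFamily_eq_zero_iff_of_surjective hsurj]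

/-- **Non-vanishing transfer, the form used for theta lifts**: if the test space `E` is the image of
the `K`-type `τ^∨` (`ι` onto) and ONE lift value is nonzero, `Θ e g₀ ≠ 0` (e.g. the value at `g₀ = 1`
of `θ(φ_∞ ⊗ φ_f, χ′)` detected by a Fourier coefficient), then the weight-`τ` form of the family is
nonzero. [folklore] -/
theorem formOfFamily_ne_zero_of_apply_ne_zero (hsurj : Surjective ι) {e : E} {g₀ : G}
    (h : Θ e g₀ ≠ 0) : formOfFamily Θ hΓ hK ι hι ≠ (0 : weightForms Γ κ τ) := fun h0 ↦
  h ((formOfFamily_eq_zero_iff_of_surjective Θ hΓ hK ι hι hsurj).mp h0 e g₀)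

/-- `formOfFamily … ≠ 0 ↔ ∃ e g, Θ e g ≠ 0` when `ι` is onto. [folklore] -/
theorem formOfFamily_ne_zero_iff_of_surjective (hsurj : Surjective ι) :
    formOfFamily Θ hΓ hK ι hι ≠ (0 : weightForms Γ κ τ) ↔ ∃ (e : E) (g : G), Θ e g ≠ 0 := by
  rw [Ne, formOfFamily_eq_zero_iff_of_surjective Θ hΓ hK ι hι hsurj]
  push Not
  rfl

/-- The value of the weight form at `g` vanishes iff all scalar forms of the family vanish at `g`
(pointwise version, `ι` onto). [folklore] -/
theorem formOfFamily_apply_eq_zero_iff_of_surjective (hsurj : Surjective ι) (g : G) :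
    (formOfFamily Θ hΓ hK ι hι : G → W) g = 0 ↔ ∀ e : E, Θ e g = 0 := by
  constructor
  · intro h e
    obtain ⟨ℓ, rfl⟩ := hsurj e
    rw [← apply_formOfFamily Θ hΓ hK ι hι g ℓ, h, map_zero]
  · intro h
    refine eq_of_forall_dual_eq fun ℓ : Dual R W ↦ ?_
    rw [apply_formOfFamily, h, map_zero]

end Form

end WeightForms

end Literature.NumberTheory.Automorphic
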